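import Mathlib
import Summits.RiemannHypothesis.RiemannHypothesis.Theses.WeilGroundState
import Summits.RiemannHypothesis.RiemannHypothesis.Theses.WeilParity
import Summits.RiemannHypothesis.RiemannHypothesis.Theorems.WeilGroundStateGroundStateSimpleEvenCellTransfer
import Summits.RiemannHypothesis.RiemannHypothesis.Theorems.WeilGroundStateGroundStateSimpleEvenFirstPrimeWindows
import Summits.RiemannHypothesis.RiemannHypothesis.Theorems.WeilGroundStateGroundStateSimpleEvenOfNoParityCrossing
import Summits.RiemannHypothesis.RiemannHypothesis.Theorems.WeilGroundStateGroundStateSimpleEvenTrialUpperE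
import Summits.RiemannHypothesis.RiemannHypothesis.Theorems.WeilGroundStateGroundStateSimpleEvenTrialUpperF
import Summits.RiemannHypothesis.RiemannHypothesis.Theorems.WeilGroundStateGroundStateSimpleEvenOddLowerE
import Summits.RiemannHypothesis.RiemannHypothesis.Theorems.WeilGroundStateGroundStateSimpleEvenOddLowerF
import Summits.RiemannHypothesis.RiemannHypothesis.Theorems.WeilParityEvenWinsBeyondArchSplit
import HarnessLib

/-!
# Crux `GroundStateSimpleEven` (stmt-RiemannHypothesis-1526), line `parity-multiplicity-commutator` (v7):
# the Connes–van Suijlekom hypothesis on EVERY window up to `63/100` — two cells beyond the second prime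

Support file (`--supports stmt-RiemannHypothesis-1526`) proving the registered sub-goal `stub_cellsEF` of
skeleton v7: for every window `(log 3)/2 < a ≤ 63/100` the bottom of the windowed Weil form is simple,
isolated and EVEN (`WeilWindowSimpleEven a`) — RH-free, through the primes `2` AND `3`.  With the landed
range `0 < a ≤ (log 3)/2` (`weilWindowSimpleEven_of_le_log_three_half`, p154633) this is the hypothesis of
Connes–van Suijlekom [CMP 2025, Thm 6.1] on the whole range `0 < a ≤ 63/100`
(`weilWindowSimpleEven_of_le_63_100`), and the residue of the crux — kernel-checked equivalent to it —
becomes "no parity tie beyond `63/100`" (`groundStateSimpleEven_iff_noParityCrossingBeyond63`).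

## Proof (two cells of the landed cell transfer `weilWindowSimpleEven_on_cell_of_le`, p137020)

| cell | `U` (Rayleigh–Ritz, Markov form) | `L` (two-prime odd-sector margin certificate) |
|---|---|---|
| `E = [549/1000, 59/100]` | `ε(549/1000) ≤ 1/12500000` (`stub_trialUpperE`, p164969; true `5.96e-8`) | `Re Q ≥ 1/2000000` at `59/100` (`stub_oddLowerE`; cert. E, `N = 149`, `T = 80`, `L_max = 6.06e-7`) |
| `F = [59/100, 63/100]`   | `ε(59/100) ≤ 1/200000000` (`stub_trialUpperF`, p165214; true `3.82e-9`) | `Re Q ≥ 3/100000000` at `63/100` (`stub_oddLowerF`; cert. F, `N = 157`, `L_max = 3.61e-8`) |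

The `L`'s are Yoshida moment-method certificates in the two-prime analytic form
(`Literature/NumberTheory/LFunctions/WeilTwoPrime*.lean`: weight `Re ψ(1/4+it/2) − √2 log 2 cos(t log 2) −
(2 log 3/√3) cos(t log 3)`, 248 certified cells on `[0, 80]`, odd block at a lowered Bessel coefficient).
-/

noncomputable section

open Set MeasureTheory Filter

open Literature.NumberTheory.LFunctions
open Summit.RiemannHypothesis.RiemannHypothesis.Theses.WeilGroundState
open Summit.RiemannHypothesis.RiemannHypothesis.Theses.WeilParity

namespace Summit.RiemannHypothesis.RiemannHypothesis.Theorems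

set_option linter.dupNamespace false in
/-- **Registered sub-goal (CELLS E, F) of line `parity-multiplicity-commutator` (v7): the crux on every
window `(log 3)/2 < a ≤ 63/100`** (two cells of the cell transfer). [folklore] -/
theorem stub_cellsEF :
    ∀ a : ℝ, Real.log 3 / 2 < a → a ≤ 63 / 100 → WeilWindowSimpleEven a := by
  intro a hlo hhi
  have hl3 := Real.log_three_gt_d9
  have h549 : (549 / 1000 : ℝ) ≤ a := by linarith
  rcases le_or_gt a (59 / 100) with h1 | h1
  · exact GroundStateSimpleEven.weilWindowSimpleEven_on_cell_of_le
      (b := 549 / 1000) (c := 59 / 100) (U := 1 / 12500000) (L := 1 / 2000000) (by norm_num) (by norm_num)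
      stub_trialUpperE stub_oddLowerE h549 h1
  · exact GroundStateSimpleEven.weilWindowSimpleEven_on_cell_of_le
      (b := 59 / 100) (c := 63 / 100) (U := 1 / 200000000) (L := 3 / 100000000) (by norm_num) (by norm_num)
      stub_trialUpperF stub_oddLowerF h1.le hhi

/-- **The Connes–van Suijlekom hypothesis on every window `0 < a ≤ 63/100` (RH-free)**: archimedean
windows + first-prime windows (`weilWindowSimpleEven_of_le_log_three_half`) + the two-prime cells E, F. [folklore] -/
theorem weilWindowSimpleEven_of_le_63_100 :
    ∀ a : ℝ, 0 < a → a ≤ 63 / 100 → WeilWindowSimpleEven a := by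
  intro a ha hhi
  rcases le_or_gt a (Real.log 3 / 2) with hle | hlt
  · exact weilWindowSimpleEven_of_le_log_three_half a ha hle
  · exact stub_cellsEF a hlt hhi

/-- **ORDER up to `63/100`**: an odd-sector gap above `ε(a)` at every window `0 < a ≤ 63/100`. [folklore] -/
theorem oddSectorGap_of_le_63_100 :
    ∀ a : ℝ, 0 < a → a ≤ 63 / 100 → ∃ δ : ℝ, 0 < δ ∧ ∀ g : ℝ → ℂ, IsWeilTest g →
      tsupport g ⊆ Icc (-a) a → ∫ t, ‖g t‖ ^ 2 = (1 : ℝ) → (∀ t, g (-t) = -g t) →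
        weilGroundEnergy a + δ ≤ (weilQuadratic g).re :=
  fun a ha hhi ↦ (GroundStateSimpleEven.weilWindowSimpleEven_iff_oddSectorGap ha).1
    (weilWindowSimpleEven_of_le_63_100 a ha hhi)

/-- **Strict parity order up to `63/100`**: `ε_ev(a) < ε_od(a)` for `0 < a ≤ 63/100`. [folklore] -/
theorem weilEvenGroundEnergy_lt_weilOddGroundEnergy_of_le_63_100 {a : ℝ} (ha : 0 < a) (hhi : a ≤ 63 / 100) :
    weilEvenGroundEnergy a < weilOddGroundEnergy a :=
  (EvenWinsBeyondArch.weilWindowSimpleEven_iff_weilEvenGroundEnergy_lt ha).1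
    (weilWindowSimpleEven_of_le_63_100 a ha hhi)

/-- **Every ground state at every window `0 < a ≤ 63/100` is a.e. even.** [folklore] -/
theorem groundStates_ae_even_of_le_63_100 :
    ∀ a : ℝ, 0 < a → a ≤ 63 / 100 → ∀ u : ℝ → ℂ, IsWeilGroundState a u →
      u =ᵐ[volume] fun t ↦ u (-t) :=
  fun a ha hhi ↦ (GroundStateSimpleEven.weilWindowSimpleEven_iff_groundStates_ae_even ha).1
    (weilWindowSimpleEven_of_le_63_100 a ha hhi)

/-! ## The residue of the crux after v7: no parity tie beyond `63/100` -/

/-- **No tie beyond `63/100` ⟹ `NoParityCrossing`** (item stmt-RiemannHypothesis-18085): on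
`((log 3)/2, 63/100]` the strict order is certified (cells E, F); beyond it is the hypothesis. [folklore] -/
theorem noParityCrossing_of_beyond_63_100
    (h : ∀ a : ℝ, 63 / 100 < a → weilEvenGroundEnergy a ≠ weilOddGroundEnergy a) : NoParityCrossing := by
  intro a ha
  rcases le_or_gt a (63 / 100) with hle | hlt
  · have ha0 : 0 < a := lt_trans (by positivity) ha
    exact ne_of_lt (weilEvenGroundEnergy_lt_weilOddGroundEnergy_of_le_63_100 ha0 hle)
  · exact h a hlt

/-- **`NoParityCrossing` ⟹ no tie beyond `63/100`** (trivial restriction, `(log 3)/2 < 63/100`). [folklore] -/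
theorem beyond_63_100_of_noParityCrossing (h : NoParityCrossing) :
    ∀ a : ℝ, 63 / 100 < a → weilEvenGroundEnergy a ≠ weilOddGroundEnergy a := by
  intro a ha
  have hl3 := Real.log_three_lt_d9
  exact h a (by linarith)

/-- **The crux from the v7 residue**: `(∀ a > 63/100, ε_ev a ≠ ε_od a) → GroundStateSimpleEven`. [folklore] -/
theorem groundStateSimpleEven_of_beyond_63_100
    (h : ∀ a : ℝ, 63 / 100 < a → weilEvenGroundEnergy a ≠ weilOddGroundEnergy a) : GroundStateSimpleEven :=
  GroundStateSimpleEven.groundStateSimpleEven_of_noParityCrossing (noParityCrossing_of_beyond_63_100 h)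

/-- **CALIBRATION after v7: the crux of route WeilGroundState is EQUIVALENT to "no parity tie beyond
`63/100`"** — everything below `63/100` is proved RH-free. [folklore] -/
theorem groundStateSimpleEven_iff_noParityCrossingBeyond_63_100 :
    GroundStateSimpleEven ↔ ∀ a : ℝ, 63 / 100 < a → weilEvenGroundEnergy a ≠ weilOddGroundEnergy a :=
  ⟨fun h ↦ beyond_63_100_of_noParityCrossing
      (GroundStateSimpleEven.noParityCrossing_of_groundStateSimpleEven h),
    groundStateSimpleEven_of_beyond_63_100⟩

/-- **Item 18085 after v7: `NoParityCrossing` ↔ no tie beyond `63/100`.** [folklore] -/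
theorem noParityCrossing_iff_beyond_63_100 :
    NoParityCrossing ↔ ∀ a : ℝ, 63 / 100 < a → weilEvenGroundEnergy a ≠ weilOddGroundEnergy a :=
  ⟨beyond_63_100_of_noParityCrossing, noParityCrossing_of_beyond_63_100⟩

end Summit.RiemannHypothesis.RiemannHypothesis.Theorems
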